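import Mathlib.RingTheory.Nilpotent.Exp
import Mathlib.Algebra.CharZero.Infinite
import Mathlib.Algebra.Polynomial.Roots
import Mathlib.Data.Matrix.Basic
import Mathlib.Algebra.Algebra.Rat
import HarnessLib

/-!
# Injectivity of the exponential on nilpotent matrices (characteristic zero)

Topic `LinearAlgebra/Matrix`; namespace `Literature.LinearAlgebra.Matrix`. For a nilpotent
matrix `A` over a field `E` of characteristic `0`, Mathlib's truncated exponential
`IsNilpotent.exp A = ∑ Aⁱ / i!` (`Mathlib.RingTheory.Nilpotent.Exp`) is a unipotent matrix. This
file proves that **`exp` is injective on nilpotent matrices** (`eq_of_exp_eq_exp`) without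
introducing a logarithm: if `exp A = exp B` then `exp (k A) = (exp A) ^ k = (exp B) ^ k = exp (k B)`
for all `k ∈ ℕ` (`exp_natCast_smul`); the entries of `exp (x A)` are polynomials in `x`
(`exp_smul_apply_eq_eval`), so each entry of the difference is a polynomial vanishing on the
infinite set `ℕ ⊆ E`, hence zero, and its linear coefficient is the corresponding entry of
`A - B`. Consequences: `exp M = 1 ⇒ M = 0` (`eq_zero_of_exp_eq_one`); and, in any `ℚ`-algebra,
the intertwining rule `X R = R Y ⇒ exp (X) R = R exp (Y)` (`exp_mul_eq_mul_exp`; with `R`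
invertible this is `R exp (Y) R⁻¹ = exp (R Y R⁻¹)`).

Used by `Literature/NumberTheory/GaloisRepresentations/WeilDeligneOfGaloisProofs.lean`: the
monodromy `N` of an `ℓ`-adic representation is determined by `ρ(u) = exp (t(u) N)`
(Deligne, Antwerp II (1973), §8.4.2).

## Mathlib

`IsNilpotent.exp`, `IsNilpotent.exp_eq_sum`, `IsNilpotent.exp_add_of_commute`,
`Polynomial.eq_zero_of_infinite_isRoot`. Mathlib (this pin) has no logarithm for nilpotent
elements and no injectivity statement for `IsNilpotent.exp` (searched `Nilpotent.log`,
`exp_injective`, `exp_eq_exp`). The tree's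
`Literature.NumberTheory.Automorphic.NilpotentExpRootHom` proves the polynomiality of the entries
in another namespace with heavier imports (root data); the ten-line proofs are repeated here to
keep this file elementary. Nothing here is declared in Mathlib's `Matrix` namespace.

## References

Folklore (N. Bourbaki, *Groupes et algèbres de Lie*, Ch. II, §6, no. 1: `exp` and `log` are
inverse bijections between nilpotent and unipotent elements).
-/

open Polynomial

namespace Literature.LinearAlgebra.Matrix

section Field

variable {E : Type*} [Field E] [CharZero E] {ι : Type*} [Fintype ι] [DecidableEq ι]

/-- `exp (x A) = ∑_{i < M} xⁱ (Aⁱ / i!)` as soon as `A ^ M = 0`. [folklore] -/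
theorem exp_smul_eq_sum {A : Matrix ι ι E} {M : ℕ} (hM : A ^ M = 0) (x : E) :
    IsNilpotent.exp (x • A) = ∑ i ∈ Finset.range M, x ^ i • ((i.factorial : E)⁻¹ • A ^ i) := by
  rw [IsNilpotent.exp_eq_sum (k := M) (by rw [smul_pow, hM, smul_zero])]
  refine Finset.sum_congr rfl fun i _ => ?_
  rw [smul_pow, smul_comm, ← algebraMap_smul E ((i.factorial : ℚ)⁻¹), map_inv₀, map_natCast]

/-- The entries of `exp (x A)` are polynomials in `x` (of degree `< M` if `A ^ M = 0`).
[folklore] -/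
theorem exp_smul_apply_eq_eval {A : Matrix ι ι E} {M : ℕ} (hM : A ^ M = 0) (x : E) (a b : ι) :
    IsNilpotent.exp (x • A) a b =
      (∑ i ∈ Finset.range M, C (((i.factorial : E)⁻¹ • A ^ i) a b) * X ^ i).eval x := by
  rw [exp_smul_eq_sum hM x]
  simp [Matrix.sum_apply, Polynomial.eval_finsetSum, mul_comm]

/-- `exp (k A) = (exp A) ^ k` for `k ∈ ℕ` (the `k A` commute). [folklore] -/
theorem exp_natCast_smul {A : Matrix ι ι E} (hA : IsNilpotent A) (k : ℕ) :
    IsNilpotent.exp ((k : E) • A) = IsNilpotent.exp A ^ k := by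
  induction k with
  | zero => simp
  | succ k ih =>
    rw [Nat.cast_succ, add_smul, one_smul, pow_succ, ← ih]
    exact IsNilpotent.exp_add_of_commute ((Commute.refl A).smul_left _) (hA.smul _) hA

omit [CharZero E] in
/-- The linear coefficient of the entry polynomial `∑_{i<M} (Aⁱ/i!)_{ab} Xⁱ` is `A_{ab}`
(`M ≥ 2`). [folklore] -/
theorem coeff_one_entryPoly (A : Matrix ι ι E) {M : ℕ} (hM : 2 ≤ M) (a b : ι) :
    (∑ i ∈ Finset.range M, C (((i.factorial : E)⁻¹ • A ^ i) a b) * X ^ i).coeff 1 = A a b := by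
  rw [Polynomial.finsetSum_coeff]
  simp only [Polynomial.coeff_C_mul_X_pow]
  rw [Finset.sum_ite_eq]
  simp [show 1 < M by omega]

/-- **`exp` is injective on nilpotent matrices** over a field of characteristic zero: if
`exp A = exp B` with `A, B` nilpotent then `A = B`. Proof without logarithm: the entries of
`exp (k A) - exp (k B) = (exp A)^k - (exp B)^k = 0` are polynomials in `k` vanishing on `ℕ`,
hence identically zero, and their linear coefficients are the entries of `A - B`. [folklore] -/
theorem eq_of_exp_eq_exp {A B : Matrix ι ι E} (hA : IsNilpotent A) (hB : IsNilpotent B)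
    (h : IsNilpotent.exp A = IsNilpotent.exp B) : A = B := by
  obtain ⟨a, ha⟩ := id hA
  obtain ⟨b, hb⟩ := id hB
  set M := a + b + 2 with hMdef
  have hAM : A ^ M = 0 := pow_eq_zero_of_le (by omega) ha
  have hBM : B ^ M = 0 := pow_eq_zero_of_le (by omega) hb
  ext i j
  set PA : E[X] := ∑ m ∈ Finset.range M, C (((m.factorial : E)⁻¹ • A ^ m) i j) * X ^ m
    with hPA
  set PB : E[X] := ∑ m ∈ Finset.range M, C (((m.factorial : E)⁻¹ • B ^ m) i j) * X ^ m
    with hPB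
  have hroot : ∀ k : ℕ, (PA - PB).IsRoot (k : E) := by
    intro k
    rw [Polynomial.IsRoot, Polynomial.eval_sub, ← exp_smul_apply_eq_eval hAM,
      ← exp_smul_apply_eq_eval hBM, exp_natCast_smul hA, exp_natCast_smul hB, h, sub_self]
  have hzero : PA - PB = 0 := by
    apply Polynomial.eq_zero_of_infinite_isRoot
    refine Set.Infinite.mono ?_ (Set.infinite_range_of_injective Nat.cast_injective)
    rintro _ ⟨k, rfl⟩
    exact hroot k
  have hcoeff := congrArg (fun p : E[X] => p.coeff 1) (sub_eq_zero.mp hzero)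
  simpa only [hPA, hPB, coeff_one_entryPoly _ (show 2 ≤ M by omega)] using hcoeff

/-- `exp M = 1` for a nilpotent matrix `M` forces `M = 0` (characteristic zero). [folklore] -/
theorem eq_zero_of_exp_eq_one {A : Matrix ι ι E} (hA : IsNilpotent A)
    (h : IsNilpotent.exp A = 1) : A = 0 :=
  eq_of_exp_eq_exp hA IsNilpotent.zero (by rw [h, IsNilpotent.exp_zero])

end Field

/-- **Intertwining rule for `exp`.** In a `ℚ`-algebra, if `X R = R Y` for nilpotent `X, Y`, then
`exp (X) R = R exp (Y)` (termwise `Xⁱ R = R Yⁱ`). For invertible `R` this is the conjugation rule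
`R exp (Y) R⁻¹ = exp (R Y R⁻¹)`; for `X = Y` it says that `exp X` commutes with the commutant of
`X`. [folklore] -/
theorem exp_mul_eq_mul_exp {A : Type*} [Ring A] [Module ℚ A] {X Y R : A} (hX : IsNilpotent X)
    (hY : IsNilpotent Y) (h : X * R = R * Y) : IsNilpotent.exp X * R = R * IsNilpotent.exp Y := by
  obtain ⟨a, ha⟩ := hX
  obtain ⟨b, hb⟩ := hY
  have haM : X ^ (a + b) = 0 := pow_eq_zero_of_le (by omega) ha
  have hbM : Y ^ (a + b) = 0 := pow_eq_zero_of_le (by omega) hb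
  rw [IsNilpotent.exp_eq_sum haM, IsNilpotent.exp_eq_sum hbM, Finset.sum_mul, Finset.mul_sum]
  refine Finset.sum_congr rfl fun i _ => ?_
  have hs : SemiconjBy R (Y ^ i) (X ^ i) := (show SemiconjBy R Y X from h.symm).pow_right i
  rw [smul_mul_assoc, mul_smul_comm, hs.eq]

end Literature.LinearAlgebra.Matrix
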